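import Summits.CriticalPhenomena.PercolationContinuityZ3.Theorems.Transplant.CayleySkeletonAdm
import Summits.CriticalPhenomena.PercolationContinuityZ3.Theorems.Transplant.SkeletonKernelGenerators
import HarnessLib

/-!
# Letters only, class two: `θ(p) = 0` for all `p ≤ p_c` on `Cay(Γ; A)` for every 2-step nilpotent `Γ` with a signed rank-2 letter quotient

builds on p205010 (kernel theorem, internal audit signed; external expert review pending).
Lane `prim-bschramm`, seat `prim-bschramm-p4` gen 10 (PART C3 of `P4-GENERAL.md`, "tier 2″": the INPUT of record for letters-only
2-step nilpotent Cayley graphs).  Helper file (`--supports stmt-CriticalPhenomena-4575 --as helper`).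

INPUT (`NilTwoSigns.SignData Γ`): `Γ` of class `≤ 2` (`γ₃(Γ) = 1`), a finite symmetric generating set `A` (the letters — NO commutators
added), an additive `φ : Γ → ℤ²`, two letters `x, y` with `φ x = e₀`, `φ y = e₁`, every other letter in `ker φ ∪ {x⁻¹, y⁻¹}`, and two
automorphisms `ν, κ` permuting `A` with `φν = −φ`, `φκ = diag(1,−1)φ`.  OUTPUT: a `CayleySign₁ Γ A` (file `CayleySkeletonAdm`), hence
**`θ_g(p) = 0` for every `p ≤ p_c` on `Cay(Γ; A)`** (`SignData.theta_eq_zero_of_le`).  The point is the corner-admissible kernel criterion: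
in class two every commutator is central, so `⁅a,b⁆ = a⁻¹b⁻¹ab`, `⁅a⁻¹,b⁆ = ⁅a,b⁻¹⁆ = ⁅a,b⁆⁻¹`, and `γ₂(Γ)` is generated by the `⁅a,b⁆` of
letter pairs (`KerGen.commutator_le_closure_T`); each of these is an admissible word of sign `σ` up to inversion (normalise `x⁻¹ ↦ x`,
`y^{−σ} ↦ y^{σ}`).  Customers: `fnGraph m` (file `CayleyFreeNilpotentLetters`, done directly), the higher Heisenberg groups with their
standard letters, sign-invariant central quotients of `N_{m,2}`.
-/

noncomputable section

namespace Summit.CriticalPhenomena.PercolationContinuityZ3.Theorems.Transplant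

namespace NilTwoSigns

open SimpleGraph Subgroup Literature.Probability.LatticeModels Literature.Probability.Percolation
open scoped commutatorElement Classical

/-- **The input: a 2-step nilpotent group with a signed rank-2 letter quotient (letters only).** [cite: KozmaNitzan2024, §4 p. 16 (Lemma 8)] -/
structure SignData (Γ : Type) [Group Γ] where
  /-- the letters -/
  A : Finset Γ
  /-- the letters are symmetric -/
  symm : ∀ a ∈ A, a⁻¹ ∈ A
  /-- the letters generate -/
  gen : Subgroup.closure (A : Set Γ) = ⊤
  /-- class `≤ 2` -/
  nil : (⊤ : Subgroup Γ).lowerCentralSeries 2 = ⊥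
  /-- the skeleton -/
  φ : Γ → Site 2
  /-- additivity -/
  map_mul : ∀ g h : Γ, φ (g * h) = φ g + φ h
  /-- the first distinguished letter -/
  x : Γ
  /-- it is a letter -/
  x_mem : x ∈ A
  /-- its height -/
  φ_x : φ x = Pi.single 0 1
  /-- the second distinguished letter -/
  y : Γ
  /-- it is a letter -/
  y_mem : y ∈ A
  /-- its height -/
  φ_y : φ y = Pi.single 1 1
  /-- every letter is in the kernel or among `x^{±1}, y^{±1}` -/
  letters : ∀ a ∈ A, φ a = 0 ∨ a = x ∨ a = x⁻¹ ∨ a = y ∨ a = y⁻¹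
  /-- the reversing automorphism -/
  ν : Γ ≃* Γ
  /-- `ν` permutes the letters -/
  ν_mem : ∀ a, ν a ∈ A ↔ a ∈ A
  /-- `φν = −φ` -/
  ν_φ : ∀ g, φ (ν g) = -φ g
  /-- the axis flip -/
  κ : Γ ≃* Γ
  /-- `κ` permutes the letters -/
  κ_mem : ∀ a, κ a ∈ A ↔ a ∈ A
  /-- `φκ = diag(1,−1)φ` -/
  κ_φ : ∀ g, φ (κ g) = flipSnd (φ g)

namespace SignData

variable {Γ : Type} [Group Γ] (D : SignData Γ)

/-- `φ g⁻¹ = −φ g`. [folklore] -/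
theorem φ_inv_eq (g : Γ) : D.φ g⁻¹ = -D.φ g := KerGen.phi_inv D.φ D.map_mul g

/-! ## §1 Class-two commutator identities -/

omit D in
/-- In class two, commutators are central. [folklore] -/
theorem comm_central (hnil : (⊤ : Subgroup Γ).lowerCentralSeries 2 = ⊥) (u v g : Γ) : g * ⁅u, v⁆ = ⁅u, v⁆ * g := by
  have h1 : ⁅u, v⁆ ∈ (⊤ : Subgroup Γ).lowerCentralSeries 1 := by
    rw [Subgroup.lowerCentralSeries_succ]; exact Subgroup.commutator_mem_commutator (Subgroup.mem_top u) (Subgroup.mem_top v)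
  have h2 : ⁅⁅u, v⁆, g⁆ ∈ (⊤ : Subgroup Γ).lowerCentralSeries 2 := by
    rw [Subgroup.lowerCentralSeries_succ]; exact Subgroup.commutator_mem_commutator h1 (Subgroup.mem_top g)
  rw [hnil, Subgroup.mem_bot, commutatorElement_eq_one_iff_commute] at h2
  exact h2.eq.symm

omit D in
/-- In class two, `⁅u, v⁆ = u⁻¹ v⁻¹ u v`. [folklore] -/
theorem comm_eq_word (hnil : (⊤ : Subgroup Γ).lowerCentralSeries 2 = ⊥) (u v : Γ) : ⁅u, v⁆ = u⁻¹ * v⁻¹ * u * v := by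
  have h := comm_central hnil u v (u * v)
  rw [commutatorElement_def] at h ⊢
  calc u * v * u⁻¹ * v⁻¹ = (u * v)⁻¹ * (u * v * (u * v * u⁻¹ * v⁻¹)) := by group
    _ = (u * v)⁻¹ * (u * v * u⁻¹ * v⁻¹ * (u * v)) := by rw [h]
    _ = u⁻¹ * v⁻¹ * u * v := by group

omit D in
/-- In class two, `⁅u⁻¹, v⁆ = ⁅u, v⁆⁻¹`. [folklore] -/
theorem comm_inv_left (hnil : (⊤ : Subgroup Γ).lowerCentralSeries 2 = ⊥) (u v : Γ) : ⁅u⁻¹, v⁆ = ⁅u, v⁆⁻¹ := by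
  have h := comm_central hnil v u u
  rw [commutatorElement_inv, commutatorElement_def, commutatorElement_def] at *
  calc u⁻¹ * v * u⁻¹⁻¹ * v⁻¹ = u⁻¹ * (v * u * v⁻¹ * u⁻¹ * u) := by group
    _ = u⁻¹ * (u * (v * u * v⁻¹ * u⁻¹)) := by rw [h]
    _ = v * u * v⁻¹ * u⁻¹ := by group

omit D in
/-- In class two, `⁅u, v⁻¹⁆ = ⁅u, v⁆⁻¹`. [folklore] -/
theorem comm_inv_right (hnil : (⊤ : Subgroup Γ).lowerCentralSeries 2 = ⊥) (u v : Γ) : ⁅u, v⁻¹⁆ = ⁅u, v⁆⁻¹ := by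
  have h := comm_central hnil v u v
  rw [commutatorElement_inv, commutatorElement_def, commutatorElement_def] at *
  calc u * v⁻¹ * u⁻¹ * v⁻¹⁻¹ = v⁻¹ * (v * u * v⁻¹ * u⁻¹ * v) := by group
    _ = v⁻¹ * (v * (v * u * v⁻¹ * u⁻¹)) := by rw [h]
    _ = v * u * v⁻¹ * u⁻¹ := by group

/-- The closure of the admissible generators of sign `σ` (abbreviation). [folklore] -/
abbrev K (σ : ℤ) : Subgroup Γ := Subgroup.closure (CayCyl.admGen D.φ D.A σ)

/-! ## §2 The corner-admissible kernel criterion -/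

section Adm

variable {σ : ℤ} (hσ : σ = 1 ∨ σ = -1)
include hσ

/-- The letter `y^{σ}` of height `σ e₁`. [folklore] -/
def yσ (_hσ : σ = 1 ∨ σ = -1) : Γ := if σ = 1 then D.y else D.y⁻¹

/-- `y^{σ}` is a letter of height `σ e₁`. [folklore] -/
theorem yσ_spec : D.yσ hσ ∈ D.A ∧ D.φ (D.yσ hσ) = σ • Pi.single 1 1 := by
  unfold yσ
  rcases hσ with rfl | rfl
  · rw [if_pos rfl]; exact ⟨D.y_mem, by rw [D.φ_y, one_smul]⟩
  · rw [if_neg (by norm_num)]; exact ⟨D.symm _ D.y_mem, by rw [D.φ_inv_eq, D.φ_y, neg_smul, one_smul]⟩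

/-- A letter is BASIC (for sign `σ`) if it is a kernel letter, `x`, or `y^{σ}`. [folklore] -/
def Basic (a : Γ) : Prop := a ∈ D.A ∧ (D.φ a = 0 ∨ a = D.x ∨ a = D.yσ hσ)

/-- Every letter is a basic letter or the inverse of one. [folklore] -/
theorem exists_basic {a : Γ} (ha : a ∈ D.A) : ∃ b, D.Basic hσ b ∧ (a = b ∨ a = b⁻¹) := by
  rcases D.letters a ha with h | rfl | rfl | rfl | rfl
  · exact ⟨a, ⟨ha, Or.inl h⟩, Or.inl rfl⟩
  · exact ⟨D.x, ⟨D.x_mem, Or.inr (Or.inl rfl)⟩, Or.inl rfl⟩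
  · exact ⟨D.x, ⟨D.x_mem, Or.inr (Or.inl rfl)⟩, Or.inr rfl⟩
  · refine ⟨D.yσ hσ, ⟨(D.yσ_spec hσ).1, Or.inr (Or.inr rfl)⟩, ?_⟩
    unfold yσ; rcases hσ with rfl | rfl
    · exact Or.inl (by rw [if_pos rfl])
    · exact Or.inr (by rw [if_neg (by norm_num), inv_inv])
  · refine ⟨D.yσ hσ, ⟨(D.yσ_spec hσ).1, Or.inr (Or.inr rfl)⟩, ?_⟩
    unfold yσ; rcases hσ with rfl | rfl
    · exact Or.inr (by rw [if_pos rfl])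
    · exact Or.inl (by rw [if_neg (by norm_num)])

/-- Basic letters have heights in `{0, e₀, σ e₁}`. [folklore] -/
theorem dir_of_basic {a : Γ} (ha : D.Basic hσ a) : CayCyl.Dir σ (D.φ a) := by
  rcases ha.2 with h | rfl | rfl
  · exact Or.inl h
  · exact Or.inr (Or.inl D.φ_x)
  · exact Or.inr (Or.inr (D.yσ_spec hσ).2)

/-- **The commutator of two BASIC letters lies in `K`.** [folklore] -/
theorem comm_basic_mem_K {a b : Γ} (ha : D.Basic hσ a) (hb : D.Basic hσ b) : ⁅a, b⁆ ∈ D.K σ := by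
  by_cases hab : D.φ a = D.φ b
  · rcases ha.2 with h0 | rfl | rfl
    · -- both kernel letters: a product of kernel letters
      have hb0 : D.φ b = 0 := hab ▸ h0
      have hka : a ∈ D.K σ := Subgroup.subset_closure (Or.inl ⟨ha.1, h0⟩)
      have hkb : b ∈ D.K σ := Subgroup.subset_closure (Or.inl ⟨hb.1, hb0⟩)
      rw [commutatorElement_def]
      exact Subgroup.mul_mem _ (Subgroup.mul_mem _ (Subgroup.mul_mem _ hka hkb) (Subgroup.inv_mem _ hka)) (Subgroup.inv_mem _ hkb)
    · -- a = x: then b = x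
      rcases hb.2 with h0 | rfl | rfl
      · rw [D.φ_x, h0] at hab; exact absurd (congrFun hab 0) (by simp)
      · rw [commutatorElement_def]; simp
      · rw [D.φ_x, (D.yσ_spec hσ).2] at hab; exact absurd (congrFun hab 0) (by simp)
    · rcases hb.2 with h0 | rfl | rfl
      · rw [(D.yσ_spec hσ).2, h0] at hab
        exact absurd (congrFun hab 1) (by rcases hσ with rfl | rfl <;> simp)
      · rw [D.φ_x, (D.yσ_spec hσ).2] at hab
        exact absurd (congrFun hab 1) (by rcases hσ with rfl | rfl <;> simp)
      · rw [commutatorElement_def]; simp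
  · -- an admissible pair: the word is the commutator
    have h : a⁻¹ * b⁻¹ * a * b ∈ CayCyl.admGen D.φ D.A σ :=
      Or.inr ⟨a, ha.1, b, hb.1, D.dir_of_basic hσ ha, D.dir_of_basic hσ hb, hab, rfl⟩
    rw [comm_eq_word D.nil]
    exact Subgroup.subset_closure h

/-- **The commutator of any two letters lies in `K`.** [folklore] -/
theorem comm_letters_mem_K {a b : Γ} (ha : a ∈ D.A) (hb : b ∈ D.A) : ⁅a, b⁆ ∈ D.K σ := by
  obtain ⟨a₀, ha₀, rfl | rfl⟩ := D.exists_basic hσ ha <;> obtain ⟨b₀, hb₀, rfl | rfl⟩ := D.exists_basic hσ hb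
  · exact D.comm_basic_mem_K hσ ha₀ hb₀
  · rw [comm_inv_right D.nil]; exact Subgroup.inv_mem _ (D.comm_basic_mem_K hσ ha₀ hb₀)
  · rw [comm_inv_left D.nil]; exact Subgroup.inv_mem _ (D.comm_basic_mem_K hσ ha₀ hb₀)
  · rw [comm_inv_left D.nil, comm_inv_right D.nil, inv_inv]; exact D.comm_basic_mem_K hσ ha₀ hb₀

/-- **THE CORNER-ADMISSIBLE KERNEL CRITERION** for letters-only class-two data. [folklore] -/
theorem ker_adm (k : Γ) (hk : D.φ k = 0) : k ∈ D.K σ := by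
  have h := KerGen.mem_closure_of_eq_zero (A := (D.A : Set Γ)) D.φ D.map_mul D.gen (fun a ha => D.symm a ha) D.φ_x D.φ_y
    (fun a ha => D.letters a ha) hk
  refine (Subgroup.closure_le _).2 ?_ h
  rintro t (⟨ht, ht0⟩ | ht)
  · exact Subgroup.subset_closure (Or.inl ⟨ht, ht0⟩)
  · obtain ⟨k, hk⟩ := Set.mem_iUnion.1 ht
    rcases k with _ | k
    · obtain ⟨a, ha, b, hb, rfl⟩ := hk
      exact D.comm_letters_mem_K hσ ha hb
    · have h1 : t = 1 := KerGen.W_eq_one_of_lowerCentralSeries_eq_bot D.nil (by omega) hk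
      rw [SetLike.mem_coe, h1]; exact Subgroup.one_mem _

end Adm

/-! ## §3 The `CayleySign₁` datum and the theorem -/

/-- Heights of the letters have sup-norm `≤ 1`. [folklore] -/
theorem lip_A (s : Γ) (hs : s ∈ D.A) (j : Fin 2) : |D.φ s j| ≤ 1 := by
  rcases D.letters s hs with h0 | rfl | rfl | rfl | rfl
  · rw [h0]; simp
  · rw [D.φ_x]; fin_cases j <;> simp
  · rw [D.φ_inv_eq, D.φ_x]; fin_cases j <;> simp
  · rw [D.φ_y]; fin_cases j <;> simp
  · rw [D.φ_inv_eq, D.φ_y]; fin_cases j <;> simp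

/-- **THE `CayleySign₁` DATUM of a letters-only class-two `SignData`.** [cite: KozmaNitzan2024, §4 p. 16 (Lemma 8)] [cite: BenjaminiSchramm1996, §2] -/
def cayleySign₁ : CayleySign₁ Γ D.A where
  φ := D.φ
  map_mul := D.map_mul
  lip := D.lip_A
  step := fun j => by
    fin_cases j
    · exact ⟨D.x, D.x_mem, D.φ_x⟩
    · exact ⟨D.y, D.y_mem, D.φ_y⟩
  inv_mem := D.symm
  ν := D.ν
  ν_mem := D.ν_mem
  ν_φ := D.ν_φ
  ker_adm := fun _ hσ k hk => D.ker_adm hσ k hk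
  κ := D.κ
  κ_mem := D.κ_mem
  κ_φ := D.κ_φ

/-- **THEOREM (letters only, class two): `θ_g(p) = 0` for every `p ≤ p_c` at every vertex of `Cay(Γ; A)`** for every 2-step nilpotent
group `Γ` and symmetric generating set `A` of letters carrying a signed rank-2 letter quotient (`SignData`) — no commutators added to the
generating set, no central element used. builds on p205010 (kernel theorem, internal audit signed; external expert review pending).
[cite: BenjaminiSchramm1996, Conj. 4; §2] [cite: AizenmanGrimmett1991, Thm 1] [cite: KozmaNitzan2024, §1 p. 2 (approach 1)] -/
theorem theta_eq_zero_of_le (g : Γ) {p : unitInterval} (hp : (p : ℝ) ≤ criticalProb (mulCayley (D.A : Set Γ)) g) :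
    theta (mulCayley (D.A : Set Γ)) g p = 0 :=
  D.cayleySign₁.theta_eq_zero_of_le g hp

end SignData

end NilTwoSigns

end Summit.CriticalPhenomena.PercolationContinuityZ3.Theorems.Transplant

end
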